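import Mathlib
import Summits.ValiantsHypothesis.ValiantsHypothesis.Theorems.LacunarySymmetroidMatrixDescartesCensusDefs
import Summits.ValiantsHypothesis.ValiantsHypothesis.Theorems.LacunarySymmetroidMatrixDescartesStubBlockSector
import Summits.ValiantsHypothesis.ValiantsHypothesis.Theorems.SymmetroidPencilBasics
import Summits.ValiantsHypothesis.ValiantsHypothesis.Theorems.KPlusLogSqLawWeakLiftingTowerGraftTowerTwoSidedWitnessTen

/-!
# Tower graft line — SIZE SUPERADDITIVITY of the support-level positive-root budget

Crux `stmt-ValiantsHypothesis-19561` (`Theses.KPlusLogSqLaw.WeakLifting`), line (B) `Cruxes/WeakLifting/Lines/tower_graft.lean`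
(restricted sub-case `TowerWeakLifting`; size-induction spine S4d/S4f/S4g).  Companion of the by-name closer of S4g
`…TowerGraft.sizeMono` (`PosRootLawSizeMono`: the budget `ζ₊(m; d)` is MONOTONE in the size `m`, by identity padding).  This file
proves the converse-direction structural fact used by the line's instrument read-outs (cell `pub-symmetroid`, LINE (B) pen val-idea-24
«free fact (2)», critic crit-6 ACK #25): the budget is SUPERADDITIVE in the size on every fixed support,

  `ζ₊(m₁ + m₂; d) ≥ ζ₊(m₁; d) + ζ₊(m₂; d)`,

typed in the tree's currency `PosRootLawOn` as `not_posRootLawOn_add`: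
`¬ PosRootLawOn m₁ K B₁ d → ¬ PosRootLawOn m₂ K B₂ d → ¬ PosRootLawOn (m₁ + m₂) K (B₁ + B₂ + 1) d`.
Mechanism (pencil level, `SizeSuperadditive.exists_blockDiag_card_posRoots_ge`): the block-diagonal direct sum of two pencils on the
same support, with the second block's letters RESCALED `S₂ l ↦ μ^{d l} • S₂ l` (`μ > 0`), has determinant
`det P₁(X) · (det P₂)(μX)` (`det_pencil_blockDiag`, `det_pencil_rescale`), so its positive roots contain those of `det P₁` and the
`1/μ`-multiples of those of `det P₂`; choosing `μ` off the finite set of root ratios makes the two sets disjoint and the counts ADD.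
Symmetry and positive semidefiniteness of the letters are preserved (`isSymm_blockDiag`, `posSemidef_blockDiag`), so the construction
stays inside every word class of the line (PSD letters with one pivot).  Consequence for the size-doubling rung (SD/S4d, S4f): the
doubling factor can never be `< 2` (`ζ₊(2m; d) ≥ 2·ζ₊(m; d)`), the trivial side of the bet.

Application (kernel floor of the tower column at `m = 4`): the 3-tower witness `T₁₀` (`…TowerTwoSidedWitnessTen`, `Z₊ ≥ 10` at `m = 3` on
`(0,1,5,25)`) in support-level currency (`not_posRootLawOn_three_0_1_5_25 : ¬ PosRootLawOn 3 4 9 ![0,1,5,25]`), the `1 × 1` pencil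
`1 − 3X + X⁵ + X²⁵` (`¬ PosRootLawOn 1 4 1 ![0,1,5,25]`), hence `¬ PosRootLawOn 4 4 11 ![0,1,5,25]`: **`ζ₊(4; (0,1,5,25)) ≥ 12 = 3m` on a
genuine 4-TOWER** (`4·0 < 1`, `4·1 < 5`, `4·5 < 25`) — the free direct-sum floor below the line's located prediction `14 = 4m − 2`
(which needs a coupled witness, not a direct sum).  Def-free.

HONEST FRAMING: elementary structure (block-diagonal pencils) + bookkeeping; it proves nothing about `WeakLifting`, Conjecture B /
`KPlusLogSqLaw`, the registered stubs S4/S4b/S4d/S4f/S5/S5ᴸ, `MatrixDescartes` (18050) or `VP ≠ VNP`.  Seat: prover val-sym-lift-p3 g19,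
`--supports stmt-ValiantsHypothesis-19561`.

[folklore] Elementary linear algebra (determinant of a block-diagonal matrix; roots of a product; rescaling `X ↦ μX`).
-/

-- `Summit.ValiantsHypothesis.ValiantsHypothesis.…` repeats a component by the D-0017 layout
-- (single-conjunct summit), which the `dupNamespace` linter flags; the name is mandated.
set_option linter.dupNamespace false

namespace Summit.ValiantsHypothesis.ValiantsHypothesis.Theorems.KPlusLogSqLaw.TowerGraft

open Finset Polynomial Matrix
open scoped BigOperators Polynomial
open Summit.ValiantsHypothesis.ValiantsHypothesis.Theorems.LacunarySymmetroidMatrixDescartes (PosRootLawOn)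
open Summit.ValiantsHypothesis.ValiantsHypothesis.Theorems.LacunarySymmetroidMatrixDescartes.StubBlockSector
  (sum_smul_fromBlocks_map)
open Summit.ValiantsHypothesis.ValiantsHypothesis.Theorems.SymmetroidDescartes (le_card_posRoots_of_alternating)

namespace SizeSuperadditive

variable {m₁ m₂ m K : ℕ}

/-- The lacunary pencil of block-diagonal letters (re-indexed `Fin m₁ ⊕ Fin m₂ ≃ Fin (m₁ + m₂)`) is the re-indexed block-diagonal
matrix of the two pencils. [folklore] -/
theorem pencil_blockDiag (d : Fin K → ℕ) (S₁ : Fin K → Matrix (Fin m₁) (Fin m₁) ℝ)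
    (S₂ : Fin K → Matrix (Fin m₂) (Fin m₂) ℝ) :
    (∑ l, ((X : ℝ[X]) ^ d l) •
        (Matrix.reindex finSumFinEquiv finSumFinEquiv (Matrix.fromBlocks (S₁ l) 0 0 (S₂ l))).map C)
      = Matrix.reindex finSumFinEquiv finSumFinEquiv
          (Matrix.fromBlocks (∑ l, ((X : ℝ[X]) ^ d l) • (S₁ l).map C) 0 0
            (∑ l, ((X : ℝ[X]) ^ d l) • (S₂ l).map C)) := by
  rw [← sum_smul_fromBlocks_map]
  ext i j
  simp only [Matrix.reindex_apply, Matrix.submatrix_apply, Matrix.sum_apply, Matrix.smul_apply, Matrix.map_apply]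

/-- Hence its determinant is the product of the two pencil determinants. [folklore] -/
theorem det_pencil_blockDiag (d : Fin K → ℕ) (S₁ : Fin K → Matrix (Fin m₁) (Fin m₁) ℝ)
    (S₂ : Fin K → Matrix (Fin m₂) (Fin m₂) ℝ) :
    Matrix.det (∑ l, ((X : ℝ[X]) ^ d l) •
        (Matrix.reindex finSumFinEquiv finSumFinEquiv (Matrix.fromBlocks (S₁ l) 0 0 (S₂ l))).map C)
      = Matrix.det (∑ l, ((X : ℝ[X]) ^ d l) • (S₁ l).map C) *
          Matrix.det (∑ l, ((X : ℝ[X]) ^ d l) • (S₂ l).map C) := by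
  rw [pencil_blockDiag, Matrix.det_reindex_self, Matrix.det_fromBlocks_zero₂₁]

/-- Evaluating the determinant of a lacunary pencil at a real point gives the determinant of the evaluated real matrix
(`det` commutes with the evaluation homomorphism). [folklore] -/
theorem eval_det_sumPencil (d : Fin K → ℕ) (S : Fin K → Matrix (Fin m) (Fin m) ℝ) (t : ℝ) :
    (Matrix.det (∑ l, ((X : ℝ[X]) ^ d l) • (S l).map C)).eval t = Matrix.det (∑ l, t ^ d l • S l) := by
  have h := RingHom.map_det (Polynomial.evalRingHom t) (∑ l, ((X : ℝ[X]) ^ d l) • (S l).map C)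
  rw [Polynomial.coe_evalRingHom] at h
  rw [h]
  congr 1
  ext i j
  simp only [RingHom.mapMatrix_apply, Matrix.map_apply, Matrix.smul_apply, Matrix.sum_apply, smul_eq_mul,
    Polynomial.coe_evalRingHom, Polynomial.eval_mul, Polynomial.eval_pow, Polynomial.eval_X, Polynomial.eval_C,
    Polynomial.eval_finsetSum]

/-- **Rescaling the letters along the support is the substitution `X ↦ μX`**: the pencil with letters `μ^{d l} • S l` has determinant
`(det P)(μX)`. [folklore] -/
theorem det_pencil_rescale (d : Fin K → ℕ) (S : Fin K → Matrix (Fin m) (Fin m) ℝ) (μ : ℝ) :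
    Matrix.det (∑ l, ((X : ℝ[X]) ^ d l) • (μ ^ d l • S l).map C)
      = (Matrix.det (∑ l, ((X : ℝ[X]) ^ d l) • (S l).map C)).comp (C μ * X) := by
  apply Polynomial.funext
  intro t
  rw [Polynomial.eval_comp, eval_det_sumPencil, eval_det_sumPencil]
  congr 1
  refine Finset.sum_congr rfl fun l _ => ?_
  rw [Polynomial.eval_mul, Polynomial.eval_C, Polynomial.eval_X, smul_smul, mul_pow, mul_comm]

/-- Block-diagonal letters with symmetric blocks are symmetric. [folklore] -/
theorem isSymm_blockDiag {A : Matrix (Fin m₁) (Fin m₁) ℝ} {D : Matrix (Fin m₂) (Fin m₂) ℝ} (hA : A.IsSymm)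
    (hD : D.IsSymm) : (Matrix.reindex finSumFinEquiv finSumFinEquiv (Matrix.fromBlocks A 0 0 D)).IsSymm :=
  (Matrix.IsSymm.fromBlocks hA (by simp) hD).submatrix _

/-- Block-diagonal letters with positive semidefinite blocks are positive semidefinite (so the direct sum stays inside the
line's word classes: PSD letters, one symmetric pivot). [folklore] -/
theorem posSemidef_blockDiag {A : Matrix (Fin m₁) (Fin m₁) ℝ} {D : Matrix (Fin m₂) (Fin m₂) ℝ} (hA : A.PosSemidef)
    (hD : D.PosSemidef) : (Matrix.reindex finSumFinEquiv finSumFinEquiv (Matrix.fromBlocks A 0 0 D)).PosSemidef := by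
  have h : (Matrix.fromBlocks A 0 0 D).PosSemidef := by
    refine PosSemidef.of_dotProduct_mulVec_nonneg (hA.1.fromBlocks (by simp) hD.1) fun x => ?_
    have hx : star x = Sum.elim (star (x ∘ Sum.inl)) (star (x ∘ Sum.inr)) := by
      ext (i | i) <;> rfl
    rw [fromBlocks_mulVec, zero_mulVec, zero_mulVec, add_zero, zero_add, hx, sumElim_dotProduct_sumElim]
    exact add_nonneg (hA.dotProduct_mulVec_nonneg _) (hD.dotProduct_mulVec_nonneg _)
  rw [Matrix.reindex_apply]
  exact h.submatrix _

/-- `p(μX) ≠ 0` for `p ≠ 0`, `μ ≠ 0`. [folklore] -/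
theorem comp_C_mul_X_ne_zero {p : ℝ[X]} (hp : p ≠ 0) {μ : ℝ} (hμ : μ ≠ 0) : p.comp (C μ * X) ≠ 0 := by
  intro h
  rcases (Polynomial.comp_eq_zero_iff.mp h) with h0 | ⟨-, h1⟩
  · exact hp h0
  · have h2 := congr_arg (fun q : ℝ[X] => q.coeff 1) h1
    simp [Polynomial.coeff_C, Polynomial.coeff_X] at h2
    exact hμ h2

/-- The distinct positive roots of `p(μX)` (`μ > 0`) are at least as many as those of `p` (`r ↦ r/μ`). [folklore] -/
theorem card_posRoots_le_comp_C_mul_X (p : ℝ[X]) {μ : ℝ} (hμ : 0 < μ) :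
    (p.roots.toFinset.filter (fun t => 0 < t)).card ≤
      ((p.comp (C μ * X)).roots.toFinset.filter (fun t => 0 < t)).card := by
  classical
  by_cases hp : p = 0
  · simp [hp]
  have hq : p.comp (C μ * X) ≠ 0 := comp_C_mul_X_ne_zero hp hμ.ne'
  refine Finset.card_le_card_of_injOn (fun r => r / μ) (fun r hr => ?_) (fun r _ r' _ h => ?_)
  · rw [Finset.mem_coe, Finset.mem_filter, Multiset.mem_toFinset, Polynomial.mem_roots hp] at hr
    rw [Finset.mem_coe, Finset.mem_filter, Multiset.mem_toFinset, Polynomial.mem_roots hq]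
    refine ⟨?_, div_pos hr.2 hμ⟩
    have h1 : μ * (r / μ) = r := by field_simp
    rw [Polynomial.IsRoot.def, Polynomial.eval_comp, Polynomial.eval_mul, Polynomial.eval_C, Polynomial.eval_X, h1]
    exact hr.1
  · simpa [div_left_inj' hμ.ne'] using h

/-- Counts of distinct positive roots ADD over a product with disjoint positive root sets. [folklore] -/
theorem card_posRoots_mul_of_disjoint (p q : ℝ[X]) (hp : p ≠ 0) (hq : q ≠ 0)
    (hdisj : Disjoint (p.roots.toFinset.filter (fun t => 0 < t)) (q.roots.toFinset.filter (fun t => 0 < t))) :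
    (p.roots.toFinset.filter (fun t => 0 < t)).card + (q.roots.toFinset.filter (fun t => 0 < t)).card
      ≤ ((p * q).roots.toFinset.filter (fun t => 0 < t)).card := by
  classical
  rw [Polynomial.roots_mul (mul_ne_zero hp hq), Multiset.toFinset_add, Finset.filter_union]
  have h := Finset.card_union_add_card_inter (p.roots.toFinset.filter (fun t => 0 < t))
    (q.roots.toFinset.filter (fun t => 0 < t))
  rw [Finset.disjoint_iff_inter_eq_empty.mp hdisj, Finset.card_empty, add_zero] at h
  exact h.ge

/-- **Pencil-level superadditivity.**  For two lacunary pencils on the same support with non-zero determinants there is a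
rescaling `μ > 0` of the second one such that the block-diagonal direct sum has at least as many distinct positive roots of its
determinant as the two pencils together. [folklore] -/
theorem exists_blockDiag_card_posRoots_ge (d : Fin K → ℕ) (S₁ : Fin K → Matrix (Fin m₁) (Fin m₁) ℝ)
    (S₂ : Fin K → Matrix (Fin m₂) (Fin m₂) ℝ)
    (h₁ : Matrix.det (∑ l, ((X : ℝ[X]) ^ d l) • (S₁ l).map C) ≠ 0)
    (h₂ : Matrix.det (∑ l, ((X : ℝ[X]) ^ d l) • (S₂ l).map C) ≠ 0) :
    ∃ μ : ℝ, 0 < μ ∧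
      ((Matrix.det (∑ l, ((X : ℝ[X]) ^ d l) • (S₁ l).map C)).roots.toFinset.filter (fun t => 0 < t)).card +
          ((Matrix.det (∑ l, ((X : ℝ[X]) ^ d l) • (S₂ l).map C)).roots.toFinset.filter (fun t => 0 < t)).card ≤
        ((Matrix.det (∑ l, ((X : ℝ[X]) ^ d l) •
            (Matrix.reindex finSumFinEquiv finSumFinEquiv
              (Matrix.fromBlocks (S₁ l) 0 0 (μ ^ d l • S₂ l))).map C)).roots.toFinset.filter (fun t => 0 < t)).card := by
  classical
  set p₁ := Matrix.det (∑ l, ((X : ℝ[X]) ^ d l) • (S₁ l).map C) with hp₁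
  set p₂ := Matrix.det (∑ l, ((X : ℝ[X]) ^ d l) • (S₂ l).map C) with hp₂
  set A := p₁.roots.toFinset.filter (fun t => 0 < t) with hA
  set B := p₂.roots.toFinset.filter (fun t => 0 < t) with hB
  set bad : Finset ℝ := (B ×ˢ A).image (fun x => x.1 / x.2) with hbad
  set μ : ℝ := 1 + ∑ b ∈ bad, |b| with hμ
  have hμpos : 0 < μ := by
    have h0 : 0 ≤ ∑ b ∈ bad, |b| := Finset.sum_nonneg fun b _ => abs_nonneg b
    linarith
  have hμgt : ∀ b ∈ bad, b < μ := fun b hb => by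
    have h0 : |b| ≤ ∑ x ∈ bad, |x| := Finset.single_le_sum (fun x _ => abs_nonneg x) hb
    have h3 : b ≤ |b| := le_abs_self b
    linarith
  refine ⟨μ, hμpos, ?_⟩
  rw [det_pencil_blockDiag, det_pencil_rescale]
  have hq : p₂.comp (C μ * X) ≠ 0 := comp_C_mul_X_ne_zero h₂ hμpos.ne'
  have hdisj : Disjoint A ((p₂.comp (C μ * X)).roots.toFinset.filter (fun t => 0 < t)) := by
    rw [Finset.disjoint_left]
    intro s hsA hsC
    rw [Finset.mem_filter, Multiset.mem_toFinset, Polynomial.mem_roots hq, Polynomial.IsRoot.def,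
      Polynomial.eval_comp, Polynomial.eval_mul, Polynomial.eval_C, Polynomial.eval_X] at hsC
    have hsB : μ * s ∈ B := by
      rw [hB, Finset.mem_filter, Multiset.mem_toFinset, Polynomial.mem_roots h₂]
      exact ⟨hsC.1, mul_pos hμpos hsC.2⟩
    have hs0 : s ≠ 0 := (Finset.mem_filter.mp hsA).2.ne'
    have hmem : μ ∈ bad := by
      rw [hbad, Finset.mem_image]
      exact ⟨(μ * s, s), Finset.mk_mem_product hsB hsA, by field_simp⟩
    exact lt_irrefl μ (hμgt μ hmem)
  calc A.card + B.card
      ≤ A.card + ((p₂.comp (C μ * X)).roots.toFinset.filter (fun t => 0 < t)).card :=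
        Nat.add_le_add_left (card_posRoots_le_comp_C_mul_X p₂ hμpos) _
    _ ≤ ((p₁ * p₂.comp (C μ * X)).roots.toFinset.filter (fun t => 0 < t)).card :=
        card_posRoots_mul_of_disjoint _ _ h₁ hq hdisj

end SizeSuperadditive

open SizeSuperadditive

/-- **SIZE SUPERADDITIVITY OF THE SUPPORT-LEVEL BUDGET** (`ζ₊(m₁ + m₂; d) ≥ ζ₊(m₁; d) + ζ₊(m₂; d)`, in `PosRootLawOn` currency):
if some symmetric size-`m₁` pencil on `d` has more than `B₁` positive roots and some symmetric size-`m₂` pencil on `d` has more than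
`B₂`, then some symmetric size-`(m₁ + m₂)` pencil on `d` has more than `B₁ + B₂ + 1` (block-diagonal direct sum with a rescaled
second block).  Converse-direction companion of S4g `sizeMono`. [folklore] -/
theorem not_posRootLawOn_add {m₁ m₂ K B₁ B₂ : ℕ} {d : Fin K → ℕ}
    (h₁ : ¬ PosRootLawOn m₁ K B₁ d) (h₂ : ¬ PosRootLawOn m₂ K B₂ d) :
    ¬ PosRootLawOn (m₁ + m₂) K (B₁ + B₂ + 1) d := by
  classical
  simp only [PosRootLawOn, not_forall, not_le] at h₁ h₂ ⊢
  obtain ⟨S₁, hS₁, hc₁⟩ := h₁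
  obtain ⟨S₂, hS₂, hc₂⟩ := h₂
  have hne₁ : Matrix.det (∑ l, ((X : ℝ[X]) ^ d l) • (S₁ l).map C) ≠ 0 := by
    intro h; rw [h] at hc₁; simp at hc₁
  have hne₂ : Matrix.det (∑ l, ((X : ℝ[X]) ^ d l) • (S₂ l).map C) ≠ 0 := by
    intro h; rw [h] at hc₂; simp at hc₂
  obtain ⟨μ, -, hle⟩ := exists_blockDiag_card_posRoots_ge d S₁ S₂ hne₁ hne₂
  refine ⟨fun l => Matrix.reindex finSumFinEquiv finSumFinEquiv (Matrix.fromBlocks (S₁ l) 0 0 (μ ^ d l • S₂ l)),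
    fun l => isSymm_blockDiag (hS₁ l) ((hS₂ l).smul _), ?_⟩
  dsimp only
  omega

/-- Iterated form: `ζ₊(n·m; d) ≥ n·ζ₊(m; d)` — a budget failure at size `m` propagates to every multiple size with the count
multiplied (`¬ PosRootLawOn m K B d → ¬ PosRootLawOn ((n+1) m) K ((n+1)(B+1) − 1) d`). [folklore] -/
theorem not_posRootLawOn_mul {m K B : ℕ} {d : Fin K → ℕ} (h : ¬ PosRootLawOn m K B d) (n : ℕ) :
    ¬ PosRootLawOn ((n + 1) * m) K ((n + 1) * (B + 1) - 1) d := by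
  induction n with
  | zero => simpa using h
  | succ n ih =>
    have h2 := not_posRootLawOn_add ih h
    have e1 : (n + 1) * m + m = (n + 1 + 1) * m := by ring
    have e2 : (n + 1) * (B + 1) - 1 + B + 1 = (n + 1 + 1) * (B + 1) - 1 := by
      have : 1 ≤ (n + 1) * (B + 1) := Nat.one_le_iff_ne_zero.mpr (by positivity)
      zify [this, (by nlinarith : 1 ≤ (n + 1 + 1) * (B + 1))]
      ring
    rw [e1, e2] at h2
    exact h2

/-! ## Application: the kernel floor of the tower column at `m = 4` -/

open TowerTwoSidedWitnessTen in
/-- The 3-tower witness `T₁₀` (`Z₊ ≥ 10`, `m = 3`, support `(0,1,5,25)` with the pivot `J` at the exponent `1`) in support-level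
currency: `ζ₊(3; (0,1,5,25)) ≥ 10`, i.e. `¬ PosRootLawOn 3 4 9 ![0, 1, 5, 25]`. -/
theorem not_posRootLawOn_three_0_1_5_25 : ¬ PosRootLawOn 3 4 9 ![0, 1, 5, 25] := by
  intro h
  have hT : (∑ l : Fin 4, ((X : ℝ[X]) ^ (![0, 1, 5, 25] : Fin 4 → ℕ) l) • ((![P₁₀ 0, J₁₀, P₁₀ 1, P₁₀ 2] :
      Fin 4 → Matrix (Fin 3) (Fin 3) ℝ) l).map C) = T₁₀ := by
    simp only [T₁₀, Fin.sum_univ_four, Fin.sum_univ_three, d₁₀, e₁₀, Matrix.cons_val_zero, Matrix.cons_val_one,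
      Matrix.cons_val_two, Matrix.cons_val_three, Matrix.head_cons, Matrix.tail_cons]
    abel
  have hS : ∀ l : Fin 4, ((![P₁₀ 0, J₁₀, P₁₀ 1, P₁₀ 2] : Fin 4 → Matrix (Fin 3) (Fin 3) ℝ) l).IsSymm := by
    have hP : ∀ k, (P₁₀ k).IsSymm := fun k => Matrix.isHermitian_iff_isSymm.mp (P₁₀_posSemidef k).1
    intro l
    fin_cases l
    · exact hP 0
    · exact J₁₀_isSymm
    · exact hP 1
    · exact hP 2
  have h9 := h _ hS
  rw [hT] at h9
  have h10 := ten_le_card_posRoots_T₁₀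
  omega

/-- The `1 × 1` pencil `1 − 3X + X⁵ + X²⁵` on the same support has two positive roots (signs `+, −, +` at `1/4, 1/2, 2`):
`ζ₊(1; (0,1,5,25)) ≥ 2`, i.e. `¬ PosRootLawOn 1 4 1 ![0, 1, 5, 25]` (the Descartes-sharp `m = 1` cell of the column). -/
theorem not_posRootLawOn_one_0_1_5_25 : ¬ PosRootLawOn 1 4 1 ![0, 1, 5, 25] := by
  intro h
  have hS : ∀ l, ((![!![1], !![-3], !![1], !![1]] : Fin 4 → Matrix (Fin 1) (Fin 1) ℝ) l).IsSymm := by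
    intro l
    exact Matrix.IsSymm.ext fun i j => by rw [Subsingleton.elim i j]
  have h1 := h _ hS
  have h2 : 2 ≤ ((Matrix.det (∑ l : Fin 4, ((X : ℝ[X]) ^ (![0, 1, 5, 25] : Fin 4 → ℕ) l) •
      ((![!![1], !![-3], !![1], !![1]] : Fin 4 → Matrix (Fin 1) (Fin 1) ℝ) l).map C)).roots.toFinset.filter
        (fun t => 0 < t)).card := by
    refine le_card_posRoots_of_alternating _ 2 ![1/4, 1/2, 2] ?_ ?_ ?_
    · refine Fin.strictMono_iff_lt_succ.2 fun j => ?_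
      fin_cases j <;> simp <;> norm_num
    · intro j; fin_cases j <;> simp
    · intro j
      fin_cases j <;> simp [Matrix.det_unique, Fin.sum_univ_four] <;> norm_num
  omega

/-- `(0, 1, 5, 25)` is a genuine 4-TOWER: every exponent exceeds `4` times every earlier one (`TowerGraftLine.IsTower 4`, unfolded). -/
theorem tower_four_0_1_5_25 : ∀ l l' : Fin 4, l < l' → 4 * (![0, 1, 5, 25] : Fin 4 → ℕ) l < (![0, 1, 5, 25] : Fin 4 → ℕ) l' := by
  decide

/-- **TOWER TWELVE AT `m = 4` (kernel floor by direct sum).**  `ζ₊(4; (0,1,5,25)) ≥ 12 = 3m` on the genuine 4-tower `(0,1,5,25)`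
with four letters: `¬ PosRootLawOn 4 4 11 ![0, 1, 5, 25]` (`10 ⊕ 2`).  The line's located prediction for a COUPLED witness is
`14 = 4m − 2`; this floor is the free part. -/
theorem not_posRootLawOn_four_0_1_5_25 : ¬ PosRootLawOn 4 4 11 ![0, 1, 5, 25] :=
  not_posRootLawOn_add not_posRootLawOn_three_0_1_5_25 not_posRootLawOn_one_0_1_5_25

/-- … and `ζ₊(6; (0,1,5,25)) ≥ 20` (`10 ⊕ 10`; note `(0,1,5,25)` is a 4-tower but NOT a 6-tower, so this is a fixed-support datum,
not a tower-column entry). -/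
theorem not_posRootLawOn_six_0_1_5_25 : ¬ PosRootLawOn 6 4 19 ![0, 1, 5, 25] :=
  not_posRootLawOn_add not_posRootLawOn_three_0_1_5_25 not_posRootLawOn_three_0_1_5_25

end Summit.ValiantsHypothesis.ValiantsHypothesis.Theorems.KPlusLogSqLaw.TowerGraft
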